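import Summits.BirchSwinnertonDyer.BirchSwinnertonDyer.Theorems.UniversalToricDescentThinCombRigidity
import HarnessLib

/-!
# Line `thin_comb` on the WALL `AdditiveSplitIMCInclusionAtThree` (stmt-BirchSwinnertonDyer-20395) — stub `stub_rigidity`
# (K1) CLOSED BY NAME (`--supports stmt-BirchSwinnertonDyer-20395`; cell `pub/bsd-wall`, lead `cruxlead-20395` g2)

The registered skeleton `Cruxes/AdditiveSplitIMCInclusionAtThree/Lines/thin_comb.lean` (pen bsd-wall-pss3x g7, sha16
a79ece25ae7a9131, registered by the lead 2026-08-29) has the stub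
`stub_rigidity : CombReflectionRigidityInt (unrIntegers 3) 3` — the thin-comb + reflection RIGIDITY lemma (card item
K1 of crux idea `thin-comb-reflection`) over `R₀ = unrIntegers 3`. It is the tree theorem
`UniversalToricDescentThinComb.combReflectionRigidityInt_unrIntegers` (`…ThinCombRigidity.lean`, p690436), proved
for every discrete valuation ring with maximal ideal `(p)`. This file states the stub verbatim and closes it.

The other five stubs of the line (`stub_frame`, `stub_charIdealPrincipal`, `stub_algFE`, `stub_twoVarCombSupply`,
`stub_descent`) are NOT addressed here; BSD is not proved by any of this; the wall stays open.
-/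

set_option linter.dupNamespace false

noncomputable section

namespace Summit.BirchSwinnertonDyer.BirchSwinnertonDyer.Theorems.UniversalToricDescentThinCombLine

open Literature.NumberTheory.EllipticCurves
open Summit.BirchSwinnertonDyer.BirchSwinnertonDyer.Theorems.UniversalToricDescentThinComb

/-- **`stub_rigidity` of line `thin_comb` (K1), closed by name**: thin-comb + reflection rigidity over
`R₀ = unrIntegers 3`, integral form — `ρ`-symmetric `G, F ∈ R₀⟦T₂⟧⟦T₁⟧` with `F ∈ (G, Φ_{3^{m+1}}(1+T₂))` on levels
`m` of unbounded order satisfy `G ∣ F`. [cite: Washington1997, §7.1–§7.2 and §13.4] -/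
theorem stub_rigidity : CombReflectionRigidityInt (unrIntegers 3) 3 :=
  combReflectionRigidityInt_unrIntegers 3

end Summit.BirchSwinnertonDyer.BirchSwinnertonDyer.Theorems.UniversalToricDescentThinCombLine

end
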